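/-
Literature/NumberTheory/ComplexMultiplication/DegenerateCMTypesAbelianKernelsExponentTwiceSquarefree.lean — pub-hodgecm2 (COR-CM), KEPT Literature
lane lit-deligne-3 gen 65, file F65g.  THEOREMS ONLY (no `def`, no named fact, no `sorry`, no instance, no notation; D-0026 net debt 0).
HC_CM is NOT proved.
-/
import Literature.NumberTheory.ComplexMultiplication.DegenerateCMTypesAbelianKernelsIndexTwiceSquarefree
import Mathlib.Data.Nat.Squarefree
import HarnessLib

/-!
# The rank of a CM type by kernels in EXPONENT `2m`, `m` ODD SQUAREFREE (any finite abelian group, any number of primes):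
# `rank(T) + #B₂(T) + Σ_{∅ ≠ D ⊆ primes(m)} φ(2Π_{q∈D} q)·#B_D(T) = |G|/2 + 1`, every index class decided by mixed differences

Topic `Literature/NumberTheory/ComplexMultiplication` (namespace `Literature.NumberTheory.ComplexMultiplication.CyclicCMType.AbelianKernels`); cell
`pub-hodgecm2` (COR-CM), KEPT Literature lane `lit-deligne-3` gen 65, file F65g — the GROUP-LEVEL synthesis of the lane's SQUAREFREE-ODD-PART programme
(g66 outlook item 1, group half): Kubota's defect regrouped by kernels, with the index classes indexed by the SETS OF PRIME DIVISORS of the exponent and each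
class decided by the lane's F65e.  The cases `m = p` and `m = pq` are the tree's `ExponentTwicePrime.typeRank_add_card_add_mul_card_eq` (F64a §1) and
`ExponentTwoOddPrimes.typeRank_add_card_kernels_eq` (F65a §1).  KERNEL ONLY: theorems; no `def`, no named fact, no instance, no notation (D-0014 ∕ D-0026
net debt `0`).  HC_CM is NOT proved here or anywhere in the lane.

## Mathematics

T. Kubota [Kubota1965], §4 LEMMA 2: for a finite abelian group `G ∋ ρ` (`ρ² = 1`) and a CM type `T` (`T ⊔ ρT = G`) the DEFECT `|G|/2 + 1 − rank(T)`
is the number of odd characters vanishing on `T`; grouped by KERNEL (White's proof of his Lemma 3 [White1993SporadicCycles]; tree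
`typeRank_add_sum_totient_eq`): `rank(T) + Σ_H φ([G:H]) = |G|/2 + 1` over the ADMISSIBLE kernels `H ∌ ρ`, `G/H` cyclic, all of whose characters
vanish on `T`.  If `g^{2m} = 1` on `G` with `m` odd squarefree, an admissible kernel has index `2d` with `d | m` (the index divides the exponent and
is even, `ρ ∉ H`), i.e. `[G:H] = 2Π_{q∈D} q` for the set `D = primeFactors([G:H]/2) ⊆ primeFactors(m)` (**`index_eq_two_mul_prod_primeFactors`**);
conversely a finite abelian group of squarefree order is cyclic, so EVERY subgroup `H ∌ ρ` of index `2Π_{q∈D} q` is admissible.  The class `D = ∅`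
(index `2`) is decided by even splitting `#(T ∩ H) = #(T ∖ H)` ([Dodson1984] §3.1.1; tree `…iff_of_index_two`), the classes `D ≠ ∅` by the lane's F65e
([Hazama2003CyclicCM] Lemma 4.6.1 mechanism + the Rédei ∕ de Bruijn ∕ Schoenberg relations [LamLeung2000] Thm. 2.2):
`Σ_{ε∈{0,1}^D} (−1)^{|ε|} #(T ∩ g·Π_{ε_q=1} x_q·H) = 0` for all `g` and all `x_q` with `x_q^q ∈ H`.  Hence, EXACTLY,

  **`rank(T) + #B₂(T) + Σ_{∅ ≠ D ⊆ primeFactors(m)} φ(2Π_{q∈D} q) · #B_D(T) = |G|/2 + 1`**  (`typeRank_add_card_add_sum_totient_mul_card_eq`)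

(`φ(2d) = φ(d) = Π_{q∈D}(q − 1)`), and `T` is NONDEGENERATE iff `B₂(T) = ∅` and `B_D(T) = ∅` for every nonempty `D`
(`typeRank_eq_iff_of_exponent_two_mul_squarefree`).  The field reading (CM subfields of degree `2Π_{q∈D} q` over which the type has vanishing mixed
differences; the Hodge conjecture for all powers off the lists) is the g66 field file.

* §0 private helpers (suffix `_es`): `isCyclic_of_squarefree_card_es` (exponent = order for squarefree order: Cauchy + `Finset.prod_primes_dvd`),
  `squarefree_two_mul_es`, `index_dvd_and_two_dvd_es`; public **`index_eq_two_mul_prod_primeFactors`**.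
* §1 **`typeRank_add_card_add_sum_totient_mul_card_eq`** (the sum over `D ∈ powerset(primeFactors m)`, `D ≠ ∅`, of `φ(2Π_D q)·#B_D`; the admissible kernels are
  partitioned by `H ↦ primeFactors([G:H]/2)` with `Finset.sum_fiberwise_of_maps_to`, each fibre identified with `B_D` by F65e's `_fintype` form on `ι = ↥D`),
  **`typeRank_eq_iff_of_exponent_two_mul_squarefree`**.

PRESEARCH (lane rule): as for F65a ∕ F65e — the regrouped Kubota count with all index classes decided is not found as printed for `m` with `≥ 3` prime
factors (corpus hybrid «rank of CM type abelian CM field exponent squarefree characters kernel», galaxy «degenerate CM type | rank of a CM-type | index of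
degeneracy», all stars: 0 relevant, earlier lane queries; the ingredients are Kubota's Lemma 2, White's regrouping, Dodson's index 2, Hazama's mechanism
and [LamLeung2000] Thm. 2.2); recorded as the lane's own elementary theorem with those citations.

HONEST REGISTER.  Unconditional and elementary given the tree.  Exponent `2m` only (`2`-part of exponent `2`; exponent `4m` needs the index-`4d` classes of
F65f and is left to the field-file generation); nothing is claimed about the Hodge classes of degenerate types.  HC_CM is NOT proved and not used.

## References

* [Kubota1965] T. Kubota, *On the field extension by complex multiplication*, Trans. AMS 118 (1965), §4 Lemma 2.
* [White1993SporadicCycles] S. P. White, *Sporadic cycles on CM abelian varieties*, Compositio Math. 88 (1993), §4, proof of Lemma 3 (p. 131).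
* [Dodson1984] B. Dodson, *The structure of Galois groups of CM-fields*, Trans. AMS 283 (1984), §3.1.1 Theorem.
* [Hazama2003CyclicCM] F. Hazama, *Hodge cycles on abelian varieties with complex multiplication by cyclic CM-fields*, J. Math. Sci. Univ. Tokyo 10
  (2003): Prop. 4.3, Lemma 4.6.1, Thm. 4.8.
* [LamLeung2000] T. Y. Lam, K. H. Leung, *On vanishing sums of roots of unity*, J. Algebra 224 (2000), Thm. 2.2 (via the lane's F65d ∕ F65e).

## Provenance

Cell `pub-hodgecm2` (COR-CM), KEPT Literature lane `lit-deligne-3` gen 65 (claim ABELIAN-EXPONENT-2SQUAREFREE-RANK; count-neutral, own lane), file F65g;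
neighbours cited by name, nothing restated: `DegenerateCMTypesAbelianKernels` (`typeRank_add_sum_totient_eq`, `forall_sum_char_eq_zero_iff_of_index_two`),
`DegenerateCMTypesAbelianKernelsIndexTwiceSquarefree` (F65e `…_fintype`).  Theorems only; net Literature debt 0.
-/

noncomputable section

open scoped BigOperators Classical

namespace Literature.NumberTheory.ComplexMultiplication

namespace CyclicCMType

namespace AbelianKernels

variable {G : Type*} [CommGroup G] [Fintype G] [DecidableEq G] {ρ : G} {T : Finset G} {m : ℕ}

/-! ## §0 Helpers: squarefree orders -/

section Helpers

/-- A finite commutative group of squarefree order is cyclic (its exponent is divisible by every prime factor of the order, hence by the order).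
[folklore] -/
private theorem isCyclic_of_squarefree_card_es {K : Type*} [CommGroup K] [Finite K] (hK : Squarefree (Nat.card K)) : IsCyclic K := by
  apply IsCyclic.of_exponent_eq_card
  apply Nat.dvd_antisymm Group.exponent_dvd_nat_card
  rw [← Nat.prod_primeFactors_of_squarefree hK]
  refine Finset.prod_primes_dvd _ (fun q hq => Nat.prime_iff.mp (Nat.prime_of_mem_primeFactors hq)) fun q hq => ?_
  haveI : Fact q.Prime := ⟨Nat.prime_of_mem_primeFactors hq⟩
  obtain ⟨g, hg⟩ := exists_prime_orderOf_dvd_card' (G := K) q (Nat.dvd_of_mem_primeFactors hq)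
  rw [← hg]
  exact Monoid.order_dvd_exponent g

/-- `2m` is squarefree for `m` odd squarefree. [folklore] -/
private theorem squarefree_two_mul_es (hm : Squarefree m) (hodd : ¬ 2 ∣ m) : Squarefree (2 * m) :=
  Nat.squarefree_mul_iff.2 ⟨(Nat.Prime.coprime_iff_not_dvd Nat.prime_two).2 hodd, Nat.prime_two.prime.squarefree, hm⟩

omit [Fintype G] [DecidableEq G] in
/-- The index of an admissible kernel divides the exponent `2m` and is even. [folklore] -/
private theorem index_dvd_and_two_dvd_es (hexp : ∀ g : G, g ^ (2 * m) = 1) {H : Subgroup G} (hρH : ρ ∉ H) (hρ2 : ρ * ρ = 1)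
    (hcyc : IsCyclic (G ⧸ H)) : H.index ∣ 2 * m ∧ 2 ∣ H.index := by
  haveI := hcyc
  refine ⟨?_, ?_⟩
  · rw [Subgroup.index_eq_card, ← IsCyclic.exponent_eq_card]
    exact Monoid.exponent_dvd_of_forall_pow_eq_one fun x => QuotientGroup.induction_on x fun g => by
      rw [← QuotientGroup.mk_pow, hexp, QuotientGroup.mk_one]
  · have hρ1 : (ρ : G ⧸ H) ≠ 1 := fun h => hρH ((QuotientGroup.eq_one_iff ρ).1 h)
    have hord : orderOf (ρ : G ⧸ H) = 2 := by
      haveI : Fact (Nat.Prime 2) := ⟨Nat.prime_two⟩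
      refine orderOf_eq_prime ?_ hρ1
      rw [pow_two, ← QuotientGroup.mk_mul, hρ2, QuotientGroup.mk_one]
    rw [Subgroup.index_eq_card, ← hord]
    exact orderOf_dvd_natCard _

omit [Fintype G] [DecidableEq G] in
/-- **The admissible kernels in exponent `2m`, `m` odd squarefree**: a subgroup `H ∌ ρ` with cyclic quotient has index `2·Π_{q ∈ D} q` for the set
`D ⊆ {primes of m}` of odd primes dividing its index (`D = primeFactors([G:H]/2)`). [cite: Kubota1965, §4 Lemma 2]
[cite: White1993SporadicCycles, §4, proof of Lemma 3 (p. 131)] -/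
theorem index_eq_two_mul_prod_primeFactors (hm : Squarefree m) (hexp : ∀ g : G, g ^ (2 * m) = 1) {H : Subgroup G}
    (hρH : ρ ∉ H) (hρ2 : ρ * ρ = 1) (hcyc : IsCyclic (G ⧸ H)) :
    (H.index / 2).primeFactors ⊆ m.primeFactors ∧ H.index = 2 * ∏ q ∈ (H.index / 2).primeFactors, q := by
  obtain ⟨hdvd, h2⟩ := index_dvd_and_two_dvd_es hexp hρH hρ2 hcyc
  have hidx : H.index = 2 * (H.index / 2) := (Nat.mul_div_cancel' h2).symm
  have hd : H.index / 2 ∣ m := Nat.dvd_of_mul_dvd_mul_left two_pos (hidx ▸ hdvd)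
  refine ⟨Nat.primeFactors_mono hd hm.ne_zero, ?_⟩
  rw [Nat.prod_primeFactors_of_squarefree (hm.squarefree_of_dvd hd)]
  exact hidx

end Helpers

/-! ## §1 The rank of a CM type in exponent `2m` (`m` odd squarefree): Kubota's defect by kernels, every index class decided -/

section ExponentTwiceSquarefree

/-- **THE RANK OF A CM TYPE BY KERNELS, EXPONENT `2m` WITH `m` ODD SQUAREFREE** (any finite commutative group `G` with `g^{2m} = 1`, conjugation
`ρ`, CM type `T`, i.e. `T ⊔ ρT = G`):

  `rank(T) + #B₂(T) + Σ_{∅ ≠ D ⊆ primes(m)} φ(2·Π_{q∈D} q) · #B_D(T) = |G|/2 + 1`,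

where `B₂(T)` is the set of index-`2` subgroups `H ∌ ρ` splitting `T` evenly (`#(T ∩ H) = #(T ∖ H)`) and, for a nonempty set `D` of prime divisors of
`m`, `B_D(T)` is the set of subgroups `H ∌ ρ` of index `2·Π_{q∈D} q` at which the `|D|`-th MIXED DIFFERENCES of the coset counts of `T` along the odd
part of `G/H` vanish: `Σ_{ε ∈ {0,1}^D} (−1)^{|ε|} #(T ∩ g·Π_{q∈D, ε_q = 1} x_q·H) = 0` for all `g ∈ G` and all `x_q` with `x_q^q ∈ H`.  Kubota's defect
`Σ_H φ([G:H])` over the admissible kernels (tree `typeRank_add_sum_totient_eq`): every admissible kernel has index `2d`, `d | m`, i.e. `2Π_{q∈D} q` for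
the set `D` of odd primes dividing its index (`index_eq_two_mul_prod_primeFactors`); a commutative group of squarefree order is cyclic, so EVERY subgroup
`H ∌ ρ` of such an index is admissible; and each index class is DECIDED — `D = ∅` by even splitting (Dodson, tree `…iff_of_index_two`), `D ≠ ∅` by the
lane's F65e (`…alternatingSum_of_index_two_mul_squarefree_fintype`: `|D| = 1` Hazama's equidistribution, `|D| = 2` additive separability).  The cases
`m = p` and `m = pq` are the tree's `ExponentTwicePrime.typeRank_add_card_add_mul_card_eq` and `ExponentTwoOddPrimes.typeRank_add_card_kernels_eq`.
[cite: Kubota1965, §4 Lemma 2] [cite: White1993SporadicCycles, §4, proof of Lemma 3 (p. 131)] [cite: Hazama2003CyclicCM, Prop. 4.3, Lemma 4.6.1 and Thm. 4.8]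
[cite: Dodson1984, §3.1.1 Theorem] [cite: LamLeung2000, Thm. 2.2] -/
theorem typeRank_add_card_add_sum_totient_mul_card_eq (hm : Squarefree m) (hodd : ¬ 2 ∣ m)
    (h : IsCMTypeWith ρ (T : Set G)) (hexp : ∀ g : G, g ^ (2 * m) = 1) :
    typeRank G (T : Set G) +
      ((Finset.univ : Finset (Subgroup G)).filter fun H => ρ ∉ H ∧ H.index = 2 ∧
        (T.filter fun s => s ∈ H).card = (T.filter fun s => s ∉ H).card).card +
      ∑ D ∈ m.primeFactors.powerset.filter (fun D => D.Nonempty),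
        (2 * ∏ q ∈ D, q).totient *
          ((Finset.univ : Finset (Subgroup G)).filter fun H => ρ ∉ H ∧ H.index = 2 * ∏ q ∈ D, q ∧
            ∀ (g : G) (x : D → G), (∀ q : D, x q ^ (q : ℕ) ∈ H) →
              ∑ ε : D → Bool, (∏ q, (if ε q then (-1 : ℤ) else 1)) *
                ((T.filter fun s => (g * ∏ q, (if ε q then x q else 1))⁻¹ * s ∈ H).card : ℤ) = 0).card =
      Fintype.card G / 2 + 1 := by
  have hρ2 : ρ * ρ = 1 := by simpa [smul_eq_mul] using h.invol (1 : G)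
  have key := typeRank_add_sum_totient_eq h
  have hm0 : m ≠ 0 := hm.ne_zero
  have h2m : Squarefree (2 * m) := squarefree_two_mul_es hm hodd
  set A := (Finset.univ : Finset (Subgroup G)).filter (fun H => ρ ∉ H ∧ IsCyclic (G ⧸ H) ∧
    ∀ χ : AddChar (Additive G) ℂ, (∀ g : G, χ (Additive.ofMul g) = 1 ↔ g ∈ H) →
      ∑ s ∈ T, χ (Additive.ofMul s) = 0) with hA
  set B₂ := (Finset.univ : Finset (Subgroup G)).filter (fun H => ρ ∉ H ∧ H.index = 2 ∧
    (T.filter fun s => s ∈ H).card = (T.filter fun s => s ∉ H).card) with hB₂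
  -- the index class of a subgroup: the odd primes dividing its index
  set cls : Subgroup G → Finset ℕ := fun H => (H.index / 2).primeFactors with hcls
  -- facts about a set `D` of primes of `m`
  have hDprime : ∀ D ∈ m.primeFactors.powerset, ∀ q ∈ D, q.Prime := fun D hD q hq =>
    Nat.prime_of_mem_primeFactors (Finset.mem_powerset.1 hD hq)
  have hDdvd : ∀ D ∈ m.primeFactors.powerset, (2 * ∏ q ∈ D, q) ∣ 2 * m := fun D hD =>
    Nat.mul_dvd_mul_left 2 ((Finset.prod_dvd_prod_of_subset _ _ _ (Finset.mem_powerset.1 hD)).trans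
      (Nat.prod_primeFactors_of_squarefree hm).dvd)
  have hclsD : ∀ D ∈ m.primeFactors.powerset, ∀ H : Subgroup G, H.index = 2 * ∏ q ∈ D, q → cls H = D := by
    intro D hD H hidx
    rw [hcls]
    dsimp only
    rw [hidx, Nat.mul_div_cancel_left _ two_pos, Nat.primeFactors_prod (hDprime D hD)]
  -- every admissible kernel lies in the class of a subset of the primes of `m`
  have hmaps : ∀ H ∈ A, cls H ∈ m.primeFactors.powerset := by
    intro H hH
    rw [hA, Finset.mem_filter] at hH
    exact Finset.mem_powerset.2 (index_eq_two_mul_prod_primeFactors hm hexp hH.2.1 hρ2 hH.2.2.1).1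
  have hidxA : ∀ H ∈ A, H.index = 2 * ∏ q ∈ cls H, q := by
    intro H hH
    rw [hA, Finset.mem_filter] at hH
    exact (index_eq_two_mul_prod_primeFactors hm hexp hH.2.1 hρ2 hH.2.2.1).2
  -- subgroups `H ∌ ρ` of index `2Π_D q` have cyclic quotient
  have hcycOf : ∀ D ∈ m.primeFactors.powerset, ∀ H : Subgroup G, H.index = 2 * ∏ q ∈ D, q → IsCyclic (G ⧸ H) := by
    intro D hD H hidx
    apply isCyclic_of_squarefree_card_es
    rw [← Subgroup.index_eq_card, hidx]
    exact h2m.squarefree_of_dvd (hDdvd D hD)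
  -- §A the class `D = ∅`: index `2`, decided by even splitting
  have hfib0 : A.filter (fun H => cls H = ∅) = B₂ := by
    rw [hA, hB₂, Finset.filter_filter]
    refine Finset.filter_congr fun H _ => ?_
    constructor
    · rintro ⟨⟨hρH, hcyc, hchar⟩, hc⟩
      have hidx : H.index = 2 := by
        have := (index_eq_two_mul_prod_primeFactors hm hexp hρH hρ2 hcyc).2
        rw [show (H.index / 2).primeFactors = ∅ from hc, Finset.prod_empty, mul_one] at this
        exact this
      exact ⟨hρH, hidx, (forall_sum_char_eq_zero_iff_of_index_two hρ2 hρH hidx T).1 hchar⟩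
    · rintro ⟨hρH, hidx, hsplit⟩
      have hidx' : H.index = 2 * ∏ q ∈ (∅ : Finset ℕ), q := by rw [Finset.prod_empty, mul_one]; exact hidx
      exact ⟨⟨hρH, hcycOf ∅ (Finset.empty_mem_powerset _) H hidx',
        (forall_sum_char_eq_zero_iff_of_index_two hρ2 hρH hidx T).2 hsplit⟩, hclsD ∅ (Finset.empty_mem_powerset _) H hidx'⟩
  -- §B the classes `D ≠ ∅`: decided by the mixed-difference criterion (F65e, family indexed by `↥D`)
  have hfibD : ∀ D ∈ m.primeFactors.powerset, D.Nonempty →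
      A.filter (fun H => cls H = D) =
        (Finset.univ : Finset (Subgroup G)).filter fun H => ρ ∉ H ∧ H.index = 2 * ∏ q ∈ D, q ∧
          ∀ (g : G) (x : D → G), (∀ q : D, x q ^ (q : ℕ) ∈ H) →
            ∑ ε : D → Bool, (∏ q, (if ε q then (-1 : ℤ) else 1)) *
              ((T.filter fun s => (g * ∏ q, (if ε q then x q else 1))⁻¹ * s ∈ H).card : ℤ) = 0 := by
    intro D hD hne
    have hne' : Nonempty D := hne.coe_sort
    have hpD : ∀ q : D, ((q : ℕ)).Prime := fun q => hDprime D hD q q.2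
    have hoddD : ∀ q : D, (q : ℕ) ≠ 2 := fun q h2 => hodd (by
      have := Nat.dvd_of_mem_primeFactors (Finset.mem_powerset.1 hD q.2)
      rwa [h2] at this)
    have hinjD : Function.Injective (fun q : D => (q : ℕ)) := Subtype.val_injective
    have hprodD : ∀ H : Subgroup G, H.index = 2 * ∏ q ∈ D, q → H.index = 2 * ∏ q : D, (q : ℕ) := fun H hidx => by
      rw [hidx, Finset.prod_coe_sort D (fun q => q)]
    rw [hA, Finset.filter_filter]
    refine Finset.filter_congr fun H _ => ?_
    constructor
    · rintro ⟨⟨hρH, hcyc, hchar⟩, hc⟩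
      have hidx : H.index = 2 * ∏ q ∈ D, q := by rw [← hc]; exact (index_eq_two_mul_prod_primeFactors hm hexp hρH hρ2 hcyc).2
      exact ⟨hρH, hidx, (forall_sum_char_eq_zero_iff_alternatingSum_of_index_two_mul_squarefree_fintype hne' hpD hinjD hoddD
        h hρH hcyc (hprodD H hidx)).1 hchar⟩
    · rintro ⟨hρH, hidx, hcrit⟩
      have hcyc := hcycOf D hD H hidx
      exact ⟨⟨hρH, hcyc, (forall_sum_char_eq_zero_iff_alternatingSum_of_index_two_mul_squarefree_fintype hne' hpD hinjD hoddD
        h hρH hcyc (hprodD H hidx)).2 hcrit⟩, hclsD D hD H hidx⟩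
  -- §C Euler's `φ` summed by classes
  have hsum : ∑ H ∈ A, H.index.totient =
      ∑ D ∈ m.primeFactors.powerset, (2 * ∏ q ∈ D, q).totient * (A.filter fun H => cls H = D).card := by
    rw [← Finset.sum_fiberwise_of_maps_to hmaps]
    refine Finset.sum_congr rfl fun D _ => ?_
    have hconst : ∀ H ∈ A.filter (fun H => cls H = D), H.index.totient = (2 * ∏ q ∈ D, q).totient := by
      intro H hH
      rw [Finset.mem_filter] at hH
      rw [hidxA H hH.1, hH.2]
    rw [Finset.sum_congr rfl hconst, Finset.sum_const, smul_eq_mul, mul_comm]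
  have hsplit : ∑ D ∈ m.primeFactors.powerset, (2 * ∏ q ∈ D, q).totient * (A.filter fun H => cls H = D).card =
      B₂.card + ∑ D ∈ m.primeFactors.powerset.filter (fun D => D.Nonempty),
        (2 * ∏ q ∈ D, q).totient * (A.filter fun H => cls H = D).card := by
    rw [Finset.sum_eq_add_sum_sdiff_singleton_of_mem (Finset.empty_mem_powerset _), Finset.prod_empty, mul_one, Nat.totient_two, one_mul,
      hfib0]
    congr 1
    refine Finset.sum_congr ?_ fun _ _ => rfl
    ext D
    simp only [Finset.mem_sdiff, Finset.mem_singleton, Finset.mem_filter, Finset.nonempty_iff_ne_empty]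
  have hsumD : ∑ D ∈ m.primeFactors.powerset.filter (fun D => D.Nonempty),
        (2 * ∏ q ∈ D, q).totient * (A.filter fun H => cls H = D).card =
      ∑ D ∈ m.primeFactors.powerset.filter (fun D => D.Nonempty),
        (2 * ∏ q ∈ D, q).totient *
          ((Finset.univ : Finset (Subgroup G)).filter fun H => ρ ∉ H ∧ H.index = 2 * ∏ q ∈ D, q ∧
            ∀ (g : G) (x : D → G), (∀ q : D, x q ^ (q : ℕ) ∈ H) →
              ∑ ε : D → Bool, (∏ q, (if ε q then (-1 : ℤ) else 1)) *
                ((T.filter fun s => (g * ∏ q, (if ε q then x q else 1))⁻¹ * s ∈ H).card : ℤ) = 0).card :=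
    Finset.sum_congr rfl fun D hD => by rw [hfibD D (Finset.mem_filter.1 hD).1 (Finset.mem_filter.1 hD).2]
  rw [hsum, hsplit, hsumD, ← add_assoc] at key
  exact key

/-- **NONDEGENERATE iff no index-`2` subgroup `H ∌ ρ` splits the type evenly and, for every nonempty set `D` of prime divisors of `m`, the mixed
differences of the coset counts vanish at NO subgroup `H ∌ ρ` of index `2Π_{q∈D} q`** (exponent `2m`, `m` odd squarefree).
[cite: Kubota1965, §4 Lemma 2] [cite: Hazama2003CyclicCM, Prop. 4.3 and Thm. 4.8] [cite: Dodson1984, §3.1.1 Theorem] -/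
theorem typeRank_eq_iff_of_exponent_two_mul_squarefree (hm : Squarefree m) (hodd : ¬ 2 ∣ m)
    (h : IsCMTypeWith ρ (T : Set G)) (hexp : ∀ g : G, g ^ (2 * m) = 1) :
    typeRank G (T : Set G) = Fintype.card G / 2 + 1 ↔
      (∀ H : Subgroup G, ρ ∉ H → H.index = 2 → (T.filter fun s => s ∈ H).card ≠ (T.filter fun s => s ∉ H).card) ∧
      ∀ D ∈ m.primeFactors.powerset, D.Nonempty → ∀ H : Subgroup G, ρ ∉ H → H.index = 2 * ∏ q ∈ D, q →
        ¬ ∀ (g : G) (x : D → G), (∀ q : D, x q ^ (q : ℕ) ∈ H) →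
          ∑ ε : D → Bool, (∏ q, (if ε q then (-1 : ℤ) else 1)) *
            ((T.filter fun s => (g * ∏ q, (if ε q then x q else 1))⁻¹ * s ∈ H).card : ℤ) = 0 := by
  have key := typeRank_add_card_add_sum_totient_mul_card_eq hm hodd h hexp
  set b := ((Finset.univ : Finset (Subgroup G)).filter fun H => ρ ∉ H ∧ H.index = 2 ∧
        (T.filter fun s => s ∈ H).card = (T.filter fun s => s ∉ H).card).card with hb
  set F : Finset ℕ → ℕ := fun D => (2 * ∏ q ∈ D, q).totient *
          ((Finset.univ : Finset (Subgroup G)).filter fun H => ρ ∉ H ∧ H.index = 2 * ∏ q ∈ D, q ∧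
            ∀ (g : G) (x : D → G), (∀ q : D, x q ^ (q : ℕ) ∈ H) →
              ∑ ε : D → Bool, (∏ q, (if ε q then (-1 : ℤ) else 1)) *
                ((T.filter fun s => (g * ∏ q, (if ε q then x q else 1))⁻¹ * s ∈ H).card : ℤ) = 0).card with hF
  have key' : typeRank G (T : Set G) + (b + ∑ D ∈ m.primeFactors.powerset.filter (fun D => D.Nonempty), F D) =
      Fintype.card G / 2 + 1 := by
    rw [← add_assoc]; exact key
  have hiff : typeRank G (T : Set G) = Fintype.card G / 2 + 1 ↔
      b = 0 ∧ ∀ D ∈ m.primeFactors.powerset.filter (fun D => D.Nonempty), F D = 0 := by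
    rw [← Finset.sum_eq_zero_iff]
    constructor
    · intro hr
      rw [hr] at key'
      constructor <;> omega
    · rintro ⟨h0, h1⟩
      rw [h0, h1, add_zero, add_zero] at key'
      exact key'
  rw [hiff]
  refine and_congr ?_ ?_
  · rw [hb, Finset.card_eq_zero, Finset.filter_eq_empty_iff]
    constructor
    · intro hno H hρH hidx heq
      exact hno (Finset.mem_univ H) ⟨hρH, hidx, heq⟩
    · rintro hno H - ⟨hρH, hidx, heq⟩
      exact hno H hρH hidx heq
  · constructor
    · intro hno D hD hne H hρH hidx hcrit
      have h0 := hno D (Finset.mem_filter.2 ⟨hD, hne⟩)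
      rw [hF] at h0
      dsimp only at h0
      rcases Nat.mul_eq_zero.1 h0 with h0 | h0
      · exact absurd h0 (Nat.pos_iff_ne_zero.1 (Nat.totient_pos.2 (Nat.mul_pos two_pos
          (Finset.prod_pos fun q hq => (Nat.prime_of_mem_primeFactors (Finset.mem_powerset.1 hD hq)).pos))))
      · rw [Finset.card_eq_zero, Finset.filter_eq_empty_iff] at h0
        exact h0 (Finset.mem_univ H) ⟨hρH, hidx, hcrit⟩
    · intro hno D hD
      rw [Finset.mem_filter] at hD
      rw [hF]
      dsimp only
      rw [Nat.mul_eq_zero]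
      right
      rw [Finset.card_eq_zero, Finset.filter_eq_empty_iff]
      rintro H - ⟨hρH, hidx, hcrit⟩
      exact hno D hD.1 hD.2 H hρH hidx hcrit

end ExponentTwiceSquarefree

end AbelianKernels

end CyclicCMType

end Literature.NumberTheory.ComplexMultiplication

end
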